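import Mathlib
import Summits.ResolutionOfSingularities.ResolutionOfSingularities.Theorems.WeightedInvariantLocalWeightedDropPureDescentBridgeTools
import Summits.ResolutionOfSingularities.ResolutionOfSingularities.Theorems.WeightedInvariantLocalWeightedDropPureDescentNoChain
import Summits.ResolutionOfSingularities.ResolutionOfSingularities.Theorems.WeightedInvariantLocalWeightedDropMonicDescentBridgeTools
import Summits.ResolutionOfSingularities.ResolutionOfSingularities.Theorems.WeightedInvariantLocalWeightedDropWildTerminalApex
import Summits.ResolutionOfSingularities.ResolutionOfSingularities.Theorems.WeightedInvariantLocalWeightedDropWildPurePowerGeneric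

/-!
# `WeightedInvariant.LocalWeightedDrop`, stub S3πM: the pure-power polyhedron descent — THE GAME BRIDGE T-6′_q, the COMPOSITION with T-5′_q, and EVERY PURELY INSEPARABLE SURFACE FORM IS WON (pieces P-B2, P-C)

Crux item stmt-ResolutionOfSingularities-8899 `LocalWeightedDrop` (route `ResolutionOfSingularities/WeightedInvariant`), registered skeleton v29
(4058ce51dfd2e5c8), stub S3πM `stub_wildPurelyInseparableReductionWon`.  [OURS · L1 W4.3, chain w43, lead prover (gen 3); a LINE UNDER THE STUB: the
pure-power polyhedron descent (second key to S3πM), MODEL Cossart–Jannsen–Saito LNM 2270 Ch. 11–13 for `J = (y^q + A)`, `e = 2`, `k = k̄` — the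
degree-2 instance is the landed key N4″ (`…Theorems.MonicDescent*`); nothing here is a statement of any manuscript.]

* successor identifications: slot `0` ↔ `c₀^q · (blowOne q (shear_{c₁/c₀} A))(c₀u₁, c₀⁻¹u₂)` (`slice_zero_eq`, from `…WildPurePowerGeneric.coeff_pointStep_succ₀`),
  slot `1` at `c₀ = 0` ↔ swapped `blowTwo q A` (`slice_one_eq`), curve `V(y,u₁)` ↔ `divOne q A` scaled (`curveSlice_zero_eq`, `…WildTerminalApex`), curve
  `V(y,u₂)` ↔ swapped `divTwo q A` (`curveSlice_one_eq`); transfer packages `transfer_diag` / `transfer_swapDiag`;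
* `won_of_curveOne` / `won_of_curveTwo` — the curve moves on a clean position (bricks `…WildPurePowerSteps.won_purePower_of_curveStep` p484790);
* `won_of_succ` — T-6′_q: at a clean position, if every Σ**_q-successor label that is a clean non-zero position gives a won germ then `y^q + A` is won
  (graph curve: shear + cleaning are free moves; point blow-up with ONE SLOT PER EXCEPTIONAL POINT, `…DescentTwo.won_purePower_of_pointStep_slot`);
* `purePower_won` — COMPOSITION with `PureDescent.noChain` (T-5′_q, p507072) by dependent choice: every clean non-zero position is won;
* `purelyInseparableFormWon` — every `y^q + A₀`, `ord A₀ > q = p^e`, over `k = k̄` of characteristic `p`, is won GIVEN the surface germs of order `< q` and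
  the order-`q` germs with one-dimensional apex: the hypotheses (H<d), (Haxis) of S3πM — the terminal-forms hypothesis of S3πM is NOT needed.
-/

set_option linter.dupNamespace false -- mandated namespace of this single-conjunct summit

noncomputable section

namespace Summit.ResolutionOfSingularities.ResolutionOfSingularities.Theorems

namespace PureDescent

open MvPowerSeries MonicDescent Literature.RingTheory.TwoVariableSeries Literature.AlgebraicGeometry.Resolution
  Literature.AlgebraicGeometry.Resolution.CobordantGame WildPurePower WildTerminal

variable {k : Type} [Field k]

/-! ## Transfer packages for `T = a · B'(Θ)`, `Θ` the diagonal / the swapped diagonal -/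

/-- A scalar identity for the chart coefficients: `c^q · (c^i · (c⁻¹)^j) = c^{i+q-j}` (`j ≤ i + q`). -/
theorem pow_mul_pow_mul_inv_pow {c : k} (hc : c ≠ 0) {q i j : ℕ} (h : j ≤ i + q) :
    c ^ q * (c ^ i * c⁻¹ ^ j) = c ^ (i + q - j) := by
  have hcj : c ^ j ≠ 0 := pow_ne_zero j hc
  have hkey : c ^ (i + q - j) * c ^ j = c ^ q * c ^ i := by
    rw [← pow_add, ← pow_add, show i + q - j + j = q + i by omega]
  rw [inv_pow]
  field_simp
  linear_combination (-1 : k) * hkey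

/-- The scalar identity in the swapped order: `c^q · ((c⁻¹)^j · c^i) = c^{i+q-j}`. -/
theorem pow_mul_inv_pow_mul_pow {c : k} (hc : c ≠ 0) {q i j : ℕ} (h : j ≤ i + q) :
    c ^ q * (c⁻¹ ^ j * c ^ i) = c ^ (i + q - j) := by
  rw [mul_comm (c⁻¹ ^ j), pow_mul_pow_mul_inv_pow hc h]

/-- DIAGONAL TRANSFER PACKAGE: for `T = a · B'(b₀u₁, b₁u₂)` (units) the three transfers of `won_slice_of_transfer` hold. -/
theorem transfer_diag [IsAlgClosed k] {q : ℕ} (hq : 0 < q) {a b₀ b₁ : k} (ha : a ≠ 0) (hb₀ : b₀ ≠ 0) (hb₁ : b₁ ≠ 0)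
    {T B' : MvPowerSeries (Fin 2) k}
    (hT : T = C a * subst (fun l : Fin 2 => if l = 0 then C b₀ * X 0 else C b₁ * (X 1 : MvPowerSeries (Fin 2) k)) B') :
    (CobordantGame.Won k (2 + 1) ((X (Fin.last 2) : MvPowerSeries (Fin (2 + 1)) k) ^ q +
        rename (Fin.succAboveEmb (Fin.last 2)) (clean q B')) →
      CobordantGame.Won k (2 + 1) ((X (Fin.last 2) : MvPowerSeries (Fin (2 + 1)) k) ^ q +
        rename (Fin.succAboveEmb (Fin.last 2)) (clean q T))) ∧
    (IsPosition q (clean q T) → IsPosition q (clean q B')) ∧ (clean q B' = 0 → clean q T = 0) := by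
  have hcl : clean q T = C a * subst (fun l : Fin 2 => if l = 0 then C b₀ * X 0 else C b₁ * (X 1 : MvPowerSeries (Fin 2) k))
      (clean q B') := by rw [hT, clean_C_mul_subst_diag]
  refine ⟨fun h => ?_, fun h => ?_, fun h => ?_⟩
  · rw [hcl, won_purePower_C_mul_iff hq ha, won_purePower_substX_iff _ (constantCoeff_diag b₀ b₁) (isUnit_det_diag hb₀ hb₁)]
    exact h
  · rw [hcl] at h; exact isPosition_of_C_mul_subst_diag ha hb₀ hb₁ h
  · rw [hcl, h, ← coe_substAlgHom (hasSubst_of_constantCoeff_zero (constantCoeff_diag b₀ b₁)), map_zero, mul_zero]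

/-- SWAPPED TRANSFER PACKAGE: for `T = a · B'(b₀u₂, b₁u₁)` (units) the three transfers hold. -/
theorem transfer_swapDiag [IsAlgClosed k] {q : ℕ} (hq : 0 < q) {a b₀ b₁ : k} (ha : a ≠ 0) (hb₀ : b₀ ≠ 0) (hb₁ : b₁ ≠ 0)
    {T B' : MvPowerSeries (Fin 2) k}
    (hT : T = C a * subst (fun l : Fin 2 => if l = 0 then C b₀ * X 1 else C b₁ * (X 0 : MvPowerSeries (Fin 2) k)) B') :
    (CobordantGame.Won k (2 + 1) ((X (Fin.last 2) : MvPowerSeries (Fin (2 + 1)) k) ^ q +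
        rename (Fin.succAboveEmb (Fin.last 2)) (clean q B')) →
      CobordantGame.Won k (2 + 1) ((X (Fin.last 2) : MvPowerSeries (Fin (2 + 1)) k) ^ q +
        rename (Fin.succAboveEmb (Fin.last 2)) (clean q T))) ∧
    (IsPosition q (clean q T) → IsPosition q (clean q B')) ∧ (clean q B' = 0 → clean q T = 0) := by
  have hcl : clean q T = C a * subst (fun l : Fin 2 => if l = 0 then C b₀ * X 1 else C b₁ * (X 0 : MvPowerSeries (Fin 2) k))
      (clean q B') := by rw [hT, clean_C_mul_subst_swapDiag]
  refine ⟨fun h => ?_, fun h => ?_, fun h => ?_⟩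
  · rw [hcl, won_purePower_C_mul_iff hq ha, won_purePower_substX_iff _ (constantCoeff_swapDiag b₀ b₁) (isUnit_det_swapDiag hb₀ hb₁)]
    exact h
  · rw [hcl] at h; exact isPosition_of_C_mul_subst_swapDiag ha hb₀ hb₁ h
  · rw [hcl, h, ← coe_substAlgHom (hasSubst_of_constantCoeff_zero (constantCoeff_swapDiag b₀ b₁)), map_zero, mul_zero]

/-! ## The four successor identifications -/

/-- The `λ`-shear family of `coeff_pointStep_succ₀` is `MonicDescent.shear (C λ)`. -/
theorem subst_shearFamily_eq_shear (la : k) (A : MvPowerSeries (Fin 2) k) :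
    subst (fun l : Fin 2 => if l = 0 then (X 0 : MvPowerSeries (Fin 2) k) else X l + C la * X 0) A = shear (C la) A := by
  have hfam : (fun l : Fin 2 => if l = 0 then (X 0 : MvPowerSeries (Fin 2) k) else X l + C la * X 0) =
      (fun i : Fin 2 => if i = 0 then (X 0 : MvPowerSeries (Fin 2) k) else X 1 + X 0 * C la) := by
    funext l
    by_cases hl : l = 0
    · rw [if_pos hl, if_pos hl]
    · have : l = 1 := by fin_cases l <;> simp_all
      rw [if_neg hl, if_neg hl, this, mul_comm]
  rw [hfam]; rfl

/-- POINT STEP, SLOT `0` (`c₀ ≠ 0`): the successor coefficient is `c₀^q · B'(c₀u₁, c₀⁻¹u₂)` with `B' = blowOne q (shear_{c₁/c₀} A)`. -/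
theorem slice_zero_eq {q : ℕ} (c : Fin 2 → k) (hc : c 0 ≠ 0) (A : MvPowerSeries (Fin 2) k) (B₀ : MvPowerSeries (Fin (2 + 1)) k)
    (hB : subst (CobordantChart.chart (fun _ : Fin 2 => 1) c) A = X 0 ^ (q + 1) * B₀) :
    TupleGame.slice (0 : Fin 2) (X 0 * B₀) =
      C (c 0 ^ q) * subst (fun l : Fin 2 => if l = 0 then C (c 0) * X 0 else C (c 0)⁻¹ * (X 1 : MvPowerSeries (Fin 2) k))
        (blowOne q (shear (C (c 1 / c 0)) A)) := by
  ext β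
  rw [coeff_pointStep_succ₀ c hc A B₀ hB β, subst_shearFamily_eq_shear, coeff_C_mul, coeff_subst_diag, coeff_blowOne]
  by_cases hle : β 1 ≤ β 0 + q
  · rw [if_pos hle, if_pos hle, ← mul_assoc, pow_mul_pow_mul_inv_pow hc hle]
  · rw [if_neg hle, if_neg hle, mul_zero, mul_zero]

/-- The identity family of `coeff_pointStep_succ₁` at `c₀ = 0` is the identity substitution. -/
theorem subst_shearFamily_one_eq_self (c : Fin 2 → k) (hc0 : c 0 = 0) (A : MvPowerSeries (Fin 2) k) :
    subst (fun l : Fin 2 => if l = 1 then (X 1 : MvPowerSeries (Fin 2) k) else X l + C (c 0 / c 1) * X 1) A = A := by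
  have hfam : (fun l : Fin 2 => if l = 1 then (X 1 : MvPowerSeries (Fin 2) k) else X l + C (c 0 / c 1) * X 1) = X := by
    funext l
    by_cases hl : l = 1
    · rw [if_pos hl, hl]
    · rw [if_neg hl, hc0, zero_div, map_zero, zero_mul, add_zero]
  rw [hfam, subst_self]
  rfl

/-- POINT STEP, SLOT `1` AT `c₀ = 0` (`c₁ ≠ 0`): the successor coefficient is `c₁^q · B'(c₁⁻¹u₂, c₁u₁)` with `B' = blowTwo q A`. -/
theorem slice_one_eq {q : ℕ} (c : Fin 2 → k) (hc0 : c 0 = 0) (hc : c 1 ≠ 0) (A : MvPowerSeries (Fin 2) k)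
    (B₀ : MvPowerSeries (Fin (2 + 1)) k) (hB : subst (CobordantChart.chart (fun _ : Fin 2 => 1) c) A = X 0 ^ (q + 1) * B₀) :
    TupleGame.slice (1 : Fin 2) (X 0 * B₀) =
      C (c 1 ^ q) * subst (fun l : Fin 2 => if l = 0 then C (c 1)⁻¹ * X 1 else C (c 1) * (X 0 : MvPowerSeries (Fin 2) k))
        (blowTwo q A) := by
  ext β
  rw [coeff_pointStep_succ₁ c hc A B₀ hB β, subst_shearFamily_one_eq_self c hc0, coeff_C_mul, coeff_subst_swapDiag, coeff_blowTwo]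
  simp only [Finsupp.add_apply, Finsupp.single_eq_same, Finsupp.single_eq_of_ne (show (0 : Fin 2) ≠ 1 by decide),
    Finsupp.single_eq_of_ne (show (1 : Fin 2) ≠ 0 by decide), add_zero, zero_add]
  by_cases hle : β 1 ≤ β 0 + q
  · rw [if_pos hle, if_pos hle, ← mul_assoc, pow_mul_inv_pow_mul_pow hc hle]
  · rw [if_neg hle, if_neg hle, mul_zero, mul_zero]

/-- CURVE STEP `V(y,u₁)`: the successor coefficient is `c^q · A''(c u₁, u₂)`. -/
theorem curveSlice_zero_eq {q : ℕ} (ci : k) (A'' : MvPowerSeries (Fin 2) k) :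
    C (ci ^ q) * TupleGame.slice (0 : Fin 2) (subst (CobordantChart.chart (fun l : Fin 2 => if l = 0 then 1 else 0)
        (fun l : Fin 2 => if l = 0 then ci else 0)) A'') =
      C (ci ^ q) * subst (fun l : Fin 2 => if l = 0 then C ci * X 0 else C 1 * (X 1 : MvPowerSeries (Fin 2) k)) A'' := by
  congr 1
  ext β
  rw [coeff_slice_subst_axisChart_zero, coeff_subst_diag, one_pow, mul_one,
    show (Finsupp.single 0 (β 0) + Finsupp.single 1 (β 1) : Fin 2 →₀ ℕ) = β from finsupp_fin2_ext (by simp) (by simp)]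

/-- CURVE STEP `V(y,u₂)`: the successor coefficient is `c^q · A''(u₂, c u₁)` (variables swapped). -/
theorem curveSlice_one_eq {q : ℕ} (ci : k) (A'' : MvPowerSeries (Fin 2) k) :
    C (ci ^ q) * TupleGame.slice (1 : Fin 2) (subst (CobordantChart.chart (fun l : Fin 2 => if l = 1 then 1 else 0)
        (fun l : Fin 2 => if l = 1 then ci else 0)) A'') =
      C (ci ^ q) * subst (fun l : Fin 2 => if l = 0 then C 1 * X 1 else C ci * (X 0 : MvPowerSeries (Fin 2) k)) A'' := by
  congr 1
  ext β
  rw [coeff_slice_subst_axisChart_one, coeff_subst_swapDiag, one_pow, one_mul, add_comm (Finsupp.single 1 (β 0))]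

/-- The `u₂`-shear is a legal plane change: invertible linear part (determinant `1`). -/
theorem isUnit_det_shearFamily (h : MvPowerSeries (Fin 2) k) :
    IsUnit (FormalCoordChange.linMat (![X 0, X 1 + X 0 * h] : Fin 2 → MvPowerSeries (Fin 2) k)).det := by
  rw [Matrix.det_fin_two]
  have h01 : coeff (Finsupp.single 1 1) ((X 0 : MvPowerSeries (Fin 2) k) * h) = 0 := by
    rw [show (X 0 : MvPowerSeries (Fin 2) k) = monomial (Finsupp.single 0 1) 1 from X_def 0, coeff_monomial_mul, if_neg]
    intro hle
    have := hle 0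
    simp at this
  simp [FormalCoordChange.linMat, coeff_X, Finsupp.single_eq_single_iff, h01]

/-! ## The curve moves on a clean position -/

section Bridge

variable (p : ℕ) (hp : p.Prime) (k : Type) [Field k] [CharP k p] [IsAlgClosed k] (e : ℕ)
  (hord : ∀ g : MvPowerSeries (Fin 3) k, CobordantGame.IsSingular k g → g.order < (p ^ e : ℕ) → CobordantGame.Won k 3 g)
  (haxis : ∀ g : MvPowerSeries (Fin 3) k, CobordantGame.IsSingular k g → g.order = (p ^ e : ℕ) →
    (∃ c : Fin 3 → k, c ≠ 0 ∧ ∀ v : Fin 3 → k,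
      CobordantChart.initEval (fun _ : Fin 3 => 1) (v + c) (p ^ e) g = CobordantChart.initEval (fun _ : Fin 3 => 1) v (p ^ e) g) →
    (∀ c₁ c₂ : Fin 3 → k,
      (∀ v : Fin 3 → k, CobordantChart.initEval (fun _ : Fin 3 => 1) (v + c₁) (p ^ e) g =
        CobordantChart.initEval (fun _ : Fin 3 => 1) v (p ^ e) g) →
      (∀ v : Fin 3 → k, CobordantChart.initEval (fun _ : Fin 3 => 1) (v + c₂) (p ^ e) g =
        CobordantChart.initEval (fun _ : Fin 3 => 1) v (p ^ e) g) →
      ∃ α β : k, (α ≠ 0 ∨ β ≠ 0) ∧ α • c₁ + β • c₂ = 0) →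
    CobordantGame.Won k 3 g)

include hp hord haxis in
/-- THE MOVE `V(y,u₁)` on a clean position with `u₁^q ∣ B`: if the cleaned quotient wins (when a non-zero position), `y^q + B` is won. -/
theorem won_of_curveOne (B : MvPowerSeries (Fin 2) k) (hcB : IsClean (p ^ e) B) (hposB : IsPosition (p ^ e) B)
    (hperm : IsPermissibleOne (p ^ e) B)
    (IH : IsPosition (p ^ e) (divOne (p ^ e) B) → divOne (p ^ e) B ≠ 0 →
      CobordantGame.Won k (2 + 1) ((X (Fin.last 2) : MvPowerSeries (Fin (2 + 1)) k) ^ (p ^ e) +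
        rename (Fin.succAboveEmb (Fin.last 2)) (divOne (p ^ e) B))) :
    CobordantGame.Won k (2 + 1) ((X (Fin.last 2) : MvPowerSeries (Fin (2 + 1)) k) ^ (p ^ e) +
      rename (Fin.succAboveEmb (Fin.last 2)) B) := by
  set q := p ^ e with hq
  have hq0 : 0 < q := pow_pos hp.pos e
  have hcD : IsClean q (divOne q B) := isClean_divOne hcB
  have hclD : clean q (divOne q B) = divOne q B := clean_eq_self_of_isClean hcD
  have hD0 : constantCoeff (divOne q B) = 0 := by
    rw [← coeff_zero_eq_constantCoeff_apply, coeff_divOne, zero_add]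
    by_contra hne
    have h := succ_le_sum_of_isPosition hposB _ hne
    simp at h
  rw [← X_pow_mul_divOne q B hperm]
  refine won_purePower_of_curveStep p hp k hq0 0 (divOne q B) hD0 fun ci hci hsing => ?_
  rw [curveSlice_zero_eq] at hsing ⊢
  obtain ⟨hw, hps, hz⟩ := transfer_diag (q := q) hq0 (pow_ne_zero q hci) hci one_ne_zero (B' := divOne q B) rfl
  refine won_slice_of_transfer p hp k e hord haxis _ (divOne q B) hw hps hz (fun hpos' hne' => ?_) hsing
  rw [hclD] at hpos' hne' ⊢
  exact IH hpos' hne'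

include hp hord haxis in
/-- THE MOVE `V(y,u₂)` on a clean position with `u₂^q ∣ B`. -/
theorem won_of_curveTwo (B : MvPowerSeries (Fin 2) k) (hcB : IsClean (p ^ e) B) (hposB : IsPosition (p ^ e) B)
    (hperm : IsPermissibleTwo (p ^ e) B)
    (IH : IsPosition (p ^ e) (divTwo (p ^ e) B) → divTwo (p ^ e) B ≠ 0 →
      CobordantGame.Won k (2 + 1) ((X (Fin.last 2) : MvPowerSeries (Fin (2 + 1)) k) ^ (p ^ e) +
        rename (Fin.succAboveEmb (Fin.last 2)) (divTwo (p ^ e) B))) :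
    CobordantGame.Won k (2 + 1) ((X (Fin.last 2) : MvPowerSeries (Fin (2 + 1)) k) ^ (p ^ e) +
      rename (Fin.succAboveEmb (Fin.last 2)) B) := by
  set q := p ^ e with hq
  have hq0 : 0 < q := pow_pos hp.pos e
  have hcD : IsClean q (divTwo q B) := isClean_divTwo hcB
  have hclD : clean q (divTwo q B) = divTwo q B := clean_eq_self_of_isClean hcD
  have hD0 : constantCoeff (divTwo q B) = 0 := by
    rw [← coeff_zero_eq_constantCoeff_apply, coeff_divTwo, zero_add]
    by_contra hne
    have h := succ_le_sum_of_isPosition hposB _ hne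
    simp at h
  rw [← X_pow_mul_divTwo q B hperm]
  refine won_purePower_of_curveStep p hp k hq0 1 (divTwo q B) hD0 fun ci hci hsing => ?_
  rw [curveSlice_one_eq] at hsing ⊢
  obtain ⟨hw, hps, hz⟩ := transfer_swapDiag (q := q) hq0 (pow_ne_zero q hci) one_ne_zero hci (B' := divTwo q B) rfl
  refine won_slice_of_transfer p hp k e hord haxis _ (divTwo q B) hw hps hz (fun hpos' hne' => ?_) hsing
  rw [hclD] at hpos' hne' ⊢
  exact IH hpos' hne'

include hp hord haxis in
/-- THE GAME BRIDGE (T-6′_q): at a clean position `A`, if every Σ**_q-successor label that is a clean non-zero position gives a won germ,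
then `y^q + A` is won — by the move of Σ**_q (curve `V(y,u₁)` / `V(y,u₂)` / graph curve after the shear / point blow-up with one slot per
exceptional point), every singular successor being an exit or formally re-presented (scaled permutation + cleaning re-centring) by a label in
`succ q A`. -/
theorem won_of_succ (A : MvPowerSeries (Fin 2) k) (hc : IsClean (p ^ e) A) (hpos : IsPosition (p ^ e) A)
    (IH : ∀ A' ∈ succ (p ^ e) A, IsClean (p ^ e) A' → IsPosition (p ^ e) A' → A' ≠ 0 →
      CobordantGame.Won k (2 + 1) ((X (Fin.last 2) : MvPowerSeries (Fin (2 + 1)) k) ^ (p ^ e) +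
        rename (Fin.succAboveEmb (Fin.last 2)) A')) :
    CobordantGame.Won k (2 + 1) ((X (Fin.last 2) : MvPowerSeries (Fin (2 + 1)) k) ^ (p ^ e) +
      rename (Fin.succAboveEmb (Fin.last 2)) A) := by
  classical
  haveI := Fact.mk hp
  haveI : PerfectRing k p := IsAlgClosed.perfectRing k p
  set q := p ^ e with hq
  have hq0 : 0 < q := pow_pos hp.pos e
  have hA00 : constantCoeff A = 0 := by
    have h0 : coeff (0 : Fin 2 →₀ ℕ) A = 0 := coeff_of_lt_order (lt_of_le_of_lt (by simp) hpos)
    simpa using h0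
  by_cases h1 : IsPermissibleOne q A
  · -- (a′) the curve `V(y,u₁)`
    refine won_of_curveOne p hp k e hord haxis A hc hpos h1 fun hpos' hne' => ?_
    exact IH _ (by rw [succ_of_isPermissibleOne h1]; exact Set.mem_singleton _) (isClean_divOne hc) hpos' hne'
  by_cases h2 : IsPermissibleTwo q A
  · -- (a′) the curve `V(y,u₂)`
    refine won_of_curveTwo p hp k e hord haxis A hc hpos h2 fun hpos' hne' => ?_
    exact IH _ (by rw [succ_of_isPermissibleTwo h1 h2]; exact Set.mem_singleton _) (isClean_divTwo hc) hpos' hne'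
  by_cases h3 : HasGraphCurve q A
  · -- (a″) a graph curve: shear (free), clean (free), then the curve `V(y, ũ₂)`
    set h := graphShear q A with hh
    obtain ⟨hnoY, hperm⟩ := graphShear_spec h3
    set B := clean q (shear h A) with hB
    have hcB : IsClean q B := isClean_clean q _
    have hposB : IsPosition q B := isPosition_clean (isPosition_shear h hpos)
    -- free moves: `y^q + A ~ y^q + shear h A ~ y^q + B`
    rw [← won_purePower_substX_iff _ (constantCoeff_shearFamily h) (isUnit_det_shearFamily (k := k) h) q A, ← shear_eq,
      won_purePower_iff_clean p hp e (shear h A) (constantCoeff_shear_eq_zero h hA00)]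
    refine won_of_curveTwo p hp k e hord haxis B hcB hposB hperm fun hpos' hne' => ?_
    exact IH _ (by rw [succ_of_hasGraphCurve h1 h2 h3]; exact Set.mem_singleton _) (isClean_divTwo hcB) hpos' hne'
  -- (b) the point blow-up, one slot per exceptional point
  have hsucc := succ_of_point h1 h2 h3
  refine won_purePower_of_pointStep_slot p hp k hq0 A hpos fun c hcex B₀ hB0 => ?_
  by_cases hc0 : c 0 ≠ 0
  · -- slot 0: the `u₁`-chart of the `λ`-sheared label, `λ = c₁/c₀`
    refine ⟨0, hc0, fun hsing => ?_⟩
    have hT := slice_zero_eq (q := q) c hc0 A B₀ hB0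
    set B' := blowOne q (shear (C (c 1 / c 0)) A) with hB'
    obtain ⟨hw, hps, hz⟩ := transfer_diag (q := q) hq0 (pow_ne_zero q hc0) hc0 (inv_ne_zero hc0) hT
    refine won_slice_of_transfer p hp k e hord haxis _ B' hw hps hz (fun hpos' hne' => ?_) hsing
    have hclB' : clean q B' = blowOne q (clean q (shear (C (c 1 / c 0)) A)) := by rw [hB', clean_blowOne]
    refine IH _ ?_ (isClean_clean q _) hpos' hne'
    rw [hsucc, hclB']
    by_cases hl : c 1 / c 0 = 0
    · left
      rw [hl, map_zero, shear_zero_eq, clean_eq_self_of_isClean hc]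
      exact Set.mem_insert _ _
    · right
      exact ⟨c 1 / c 0, hl, rfl⟩
  · -- slot 1 at `c₀ = 0`: the `u₂`-chart (variables swapped)
    rw [not_not] at hc0
    have hc1 : c 1 ≠ 0 := by
      obtain ⟨i, hi⟩ := hcex
      have : i = 0 ∨ i = 1 := by fin_cases i <;> simp
      rcases this with rfl | rfl
      · exact absurd hc0 hi
      · exact hi
    refine ⟨1, hc1, fun hsing => ?_⟩
    have hT := slice_one_eq (q := q) c hc0 hc1 A B₀ hB0
    obtain ⟨hw, hps, hz⟩ := transfer_swapDiag (q := q) hq0 (pow_ne_zero q hc1) (inv_ne_zero hc1) hc1 hT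
    refine won_slice_of_transfer p hp k e hord haxis _ (blowTwo q A) hw hps hz (fun hpos' hne' => ?_) hsing
    have hclB' : clean q (blowTwo q A) = blowTwo q A := by rw [clean_blowTwo, clean_eq_self_of_isClean hc]
    rw [hclB'] at hpos' hne' ⊢
    refine IH _ ?_ (isClean_blowTwo hc) hpos' hne'
    rw [hsucc]
    left
    exact Set.mem_insert_of_mem _ rfl

include hp hord haxis in
/-- THE COMPOSITION: T-6′_q (`won_of_succ`) + T-5′_q (`noChain`) ⇒ EVERY CLEAN NON-ZERO POSITION `y^q + A` IS WON (dependent choice on the set of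
clean non-zero positions whose germ is not won). -/
theorem purePower_won (A : MvPowerSeries (Fin 2) k) (hc : IsClean (p ^ e) A) (hpos : IsPosition (p ^ e) A) (hA0 : A ≠ 0) :
    CobordantGame.Won k (2 + 1) ((X (Fin.last 2) : MvPowerSeries (Fin (2 + 1)) k) ^ (p ^ e) +
      rename (Fin.succAboveEmb (Fin.last 2)) A) := by
  classical
  haveI := Fact.mk hp
  haveI : PerfectRing k p := IsAlgClosed.perfectRing k p
  set q := p ^ e with hq
  by_contra hnot
  let Bad : Set (MvPowerSeries (Fin 2) k) := {B | IsClean q B ∧ IsPosition q B ∧ B ≠ 0 ∧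
    ¬ CobordantGame.Won k (2 + 1) ((X (Fin.last 2) : MvPowerSeries (Fin (2 + 1)) k) ^ q + rename (Fin.succAboveEmb (Fin.last 2)) B)}
  have hnext : ∀ B ∈ Bad, ∃ B' ∈ succ q B, B' ∈ Bad := by
    rintro B ⟨hcB, hposB, hB0, hnw⟩
    by_contra hall
    push Not at hall
    exact hnw (won_of_succ p hp k e hord haxis B hcB hposB fun B' hB' hc' hpos' hne' => by
      by_contra hn
      exact hall B' hB' ⟨hc', hpos', hne', hn⟩)
  choose! nxt hnxt using hnext
  let seq : ℕ → MvPowerSeries (Fin 2) k := fun m => Nat.rec A (fun _ B => nxt B) m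
  have hseq : ∀ m, seq m ∈ Bad := by
    intro m
    induction m with
    | zero => exact ⟨hc, hpos, hA0, hnot⟩
    | succ m ih => exact (hnxt _ ih).2
  exact noChain p hp k e ⟨seq, fun m => ⟨(hseq m).1, (hseq m).2.1, (hseq m).2.2.1, (hnxt _ (hseq m)).1⟩⟩

end Bridge

/-- EVERY PURELY INSEPARABLE SURFACE FORM `y^q + A₀(x₁,x₂)` (`ord A₀ > q = p^e`) IS WON in the local weighted resolution game over an algebraically
closed field of characteristic `p`, GIVEN the surface germs of order `< q` and the order-`q` germs with a one-dimensional apex (the pure-power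
polyhedron descent: clean `A₀` by a re-centring; if nothing is left the germ is `y^q`, won in one move; otherwise `purePower_won`). -/
theorem purelyInseparableFormWon (p : ℕ) (hp : p.Prime) (k : Type) [Field k] [CharP k p] [IsAlgClosed k] (e : ℕ)
    (hord : ∀ g : MvPowerSeries (Fin 3) k, CobordantGame.IsSingular k g → g.order < (p ^ e : ℕ) → CobordantGame.Won k 3 g)
    (haxis : ∀ g : MvPowerSeries (Fin 3) k, CobordantGame.IsSingular k g → g.order = (p ^ e : ℕ) →
      (∃ c : Fin 3 → k, c ≠ 0 ∧ ∀ v : Fin 3 → k,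
        CobordantChart.initEval (fun _ : Fin 3 => 1) (v + c) (p ^ e) g = CobordantChart.initEval (fun _ : Fin 3 => 1) v (p ^ e) g) →
      (∀ c₁ c₂ : Fin 3 → k,
        (∀ v : Fin 3 → k, CobordantChart.initEval (fun _ : Fin 3 => 1) (v + c₁) (p ^ e) g =
          CobordantChart.initEval (fun _ : Fin 3 => 1) v (p ^ e) g) →
        (∀ v : Fin 3 → k, CobordantChart.initEval (fun _ : Fin 3 => 1) (v + c₂) (p ^ e) g =
          CobordantChart.initEval (fun _ : Fin 3 => 1) v (p ^ e) g) →
        ∃ α β : k, (α ≠ 0 ∨ β ≠ 0) ∧ α • c₁ + β • c₂ = 0) →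
      CobordantGame.Won k 3 g)
    (A₀ : MvPowerSeries (Fin 2) k) (hA₀ : ((p ^ e : ℕ) : ℕ∞) < A₀.order) :
    CobordantGame.Won k 3 ((X (Fin.last 2) : MvPowerSeries (Fin 3) k) ^ (p ^ e) + rename (Fin.succAboveEmb (Fin.last 2)) A₀) := by
  classical
  haveI := Fact.mk hp
  haveI : PerfectRing k p := IsAlgClosed.perfectRing k p
  have hpos : IsPosition (p ^ e) A₀ := hA₀
  have hA00 : constantCoeff A₀ = 0 := by
    have h0 : coeff (0 : Fin 2 →₀ ℕ) A₀ = 0 := coeff_of_lt_order (lt_of_le_of_lt (by simp) hpos)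
    simpa using h0
  show CobordantGame.Won k (2 + 1) ((X (Fin.last 2) : MvPowerSeries (Fin (2 + 1)) k) ^ (p ^ e) +
    rename (Fin.succAboveEmb (Fin.last 2)) A₀)
  rw [won_purePower_iff_clean p hp e A₀ hA00]
  by_cases h0 : clean (p ^ e) A₀ = 0
  · rw [h0, map_zero, add_zero]
    exact won_X_pow_last 2 (p ^ e)
  · exact purePower_won p hp k e hord haxis (clean (p ^ e) A₀) (isClean_clean _ _) (isPosition_clean hpos) h0

end PureDescent

end Summit.ResolutionOfSingularities.ResolutionOfSingularities.Theorems

end
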